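import Summits.HubbardSuperconductivity.HubbardSuperconductivity.Theorems.AnisotropyChordTransferFibre3FinXDCheck

/-!
# Route `AnisotropyChord` / H0 rotor rung: FIN per-`L` row-D (KT-2a″) SUB-CELL facts, `L = 11` (6–11)

Row-D facts `xdCellAny0 11 (49/50) la lb aD = true` on quarter sub-cells of the combined cells whose side condition needs `aD ≈ .04` (mechhunt STATUS p3 g7 REPORT 3).
Prover seat `hubbard-h0-rotor-p3` g7; helper for piece A = stmt-HubbardSuperconductivity-23918 of rung 19089 (`--supports`, helper class).
WHAT THIS IS NOT: nothing here proves superconductivity in the Hubbard model (rotor TARGET as worded stays FALSE, g15 verdict); kernel facts /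
assembly for ONE conditional reduction at one `L`.  No sorry.
-/

set_option linter.dupNamespace false
set_option autoImplicit false

namespace Summit.HubbardSuperconductivity.HubbardSuperconductivity.Theorems.AnisotropyChord.Transfer.Fibre3

namespace FinXD

/-- row-D sub-cell `[14451164716753644, 14540369437227431]` of `L = 11`. [folklore] -/
theorem xd11s_138_2 : xdCellAny0 11 (49/50 : ℚ) 14451164716753644 14540369437227431 (1/25 : ℚ) = true := by decide +kernel

/-- row-D sub-cell `[14540369437227431, 14629574157701219]` of `L = 11`. [folklore] -/
theorem xd11s_138_3 : xdCellAny0 11 (49/50 : ℚ) 14540369437227431 14629574157701219 (1/25 : ℚ) = true := by decide +kernel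

/-- row-D sub-cell `[14629574157701219, 14721008996186852]` of `L = 11`. [folklore] -/
theorem xd11s_139_0 : xdCellAny0 11 (49/50 : ℚ) 14629574157701219 14721008996186852 (1/25 : ℚ) = true := by decide +kernel

/-- row-D sub-cell `[14721008996186852, 14812443834672485]` of `L = 11`. [folklore] -/
theorem xd11s_139_1 : xdCellAny0 11 (49/50 : ℚ) 14721008996186852 14812443834672485 (1/25 : ℚ) = true := by decide +kernel

/-- row-D sub-cell `[14812443834672485, 14903878673158118]` of `L = 11`. [folklore] -/
theorem xd11s_139_2 : xdCellAny0 11 (49/50 : ℚ) 14812443834672485 14903878673158118 (1/25 : ℚ) = true := by decide +kernel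

/-- row-D sub-cell `[14903878673158118, 14995313511643751]` of `L = 11`. [folklore] -/
theorem xd11s_139_3 : xdCellAny0 11 (49/50 : ℚ) 14903878673158118 14995313511643751 (1/25 : ℚ) = true := by decide +kernel

end FinXD

end Summit.HubbardSuperconductivity.HubbardSuperconductivity.Theorems.AnisotropyChord.Transfer.Fibre3
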